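import Literature.AnabelianGeometry.EtaleTheta.Discharge.Sec2Cor219iiiAtModelChi
import Literature.AnabelianGeometry.EtaleTheta.Discharge.Sec2TowerRowsAtModelTateOfExtendsParity
import HarnessLib

/-!
# [EtTh] Cor. 2.19 (iii) and the Cor. 2.18 (iv) tower rows AT THE TATE DATUM OF RECORD with the displayed clause (H)
# SPLIT: its Cor. 2.18 (i)-type half (H-a) DISCHARGED from hextΔ; residual = {hextΔ | hextPar, (H-b) value clause}
# (proof-only; abc-iut-L2-lead gen 7 R1064 «GO L2-d1 (H)-SPLIT KNIT», follow-up of the R1025 census)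

S. Mochizuki, *The étale theta function and its Frobenioid-theoretic manifestations* [EtTh], Publ. RIMS **45** (2009), §2:
Cor. 2.19 (iii) p. 64 (printed 290) [cite: MochizukiEtTh2009, Cor 2.19 (iii) p.64] «every automorphism of the mono-theta
environment preserves the theta classes up to a constant multiple», Cor. 2.18 (i) p. 60 (the subquotients `(l·Δ_Θ)`,
`(Π^tp_X)^Θ` are group-theoretic), Cor. 2.18 (iv) p. 61 (lifting of automorphisms), Prop. 2.4 (i) p. 38.

abc-iut cell, layer L2, seat abc-iut-L2-d1 (gen 7); row R1025 / R1064 (the ONE knit the census STATUS 2026-08-27T03:44Z named).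
PROOF-ONLY: 0 definitions / instances / `Prop` facts; nothing of another seat edited or restated — inputs consumed BY NAME.

STATE OF RECORD.  abc-iut-L1-t6's `cor219_iii_modelTate_inr_of_const_conjugator` (p490953) gives F-0650
`ThetaEnvTower.Cor219_iii` for the tower of the datum of record (`modelχq p 1 2`, `E := etaleThetaDataχqInr p`, record
`X̲̲`-choice `C.Huu = Huuχq`, any tower `τ`) modulo ONE displayed clause (H): for every admissible `(γ, hγ, γμ, hcompat)` on the
tower's `Π^tp_X̲̲ = C.Huu`, (H-a) `γ` stabilises `Ker(θ|_{Π^tp_X̲̲})` and the tower's `θ⁻¹(l·Δ_Θ)` (Cor. 2.18 (i) clauses (4)(5)), and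
(H-b) for every induced `γΛ` SOME root cocycle `f₀` and SOME `w ∈ Π^tp_X̲̲` satisfy the VALUE identity at `b₀ = inl(b̂^{ι(1)²})` at
every level (the level-constant-conjugator clause; row «COR219III-M1b-EVEN (β)» (β1), abc-iut-w5-d187 / route M2).
abc-iut-f-148's p491715 gives the Cor. 2.18 (iv) surjectivity / odd-bijectivity rows and the §2 census conjunction at the datum
⟸ {hextPar, h219iii := F-0650 at the datum} for EVERY `p`.

THIS FILE.  (H-a) is NOT independent content: the tower's two subgroups are LITERALLY the setting's `Ker θ` and
`θ⁻¹(l·Δ_Θ)` cut out on `C.Huu` (`TowerOfSetting` / `RigidOfSetting`: `(D.lDeltaTheta l).comap (D.toTheta.comp C.Huu.subtype)`),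
so this seat's base's backbone (`map_subgroupOf_Huu_eq_of_extends` + `map_ker_toTheta_eq` / `map_comap_lDeltaTheta_eq`,
abc-iut-L2-d1 gen 4, p417661) discharges (H-a) for every `γ` admitting a `Δ^tp_X`-stabilising extension `Γ` to `Π^tp_X`:
* `cor219_iii_modelTate_inr_of_extends_of_value` — **F-0650 at the datum ⟸ {hextΔ (2-clause), (H-b)}**;
* `rigidData_cor218_iv_surjective_modAll_modelTate_inr_of_extends_of_value` (F-0625), `thetaEnvData_…` (F-0639, the input
  `hsurj` of layer L6's [IUTchII] Prop. 1.5 bridges), `cor218_iv_bijective_of_odd_modelTate_inr_of_extends_of_value` (F-0647),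
  `sec2_tower_rows_modelTate_inr_of_extends_of_value` (Cor. 2.16 ∧ Cor. 2.18 (iv) reduction ∧ odd bijectivity ∧ Cor. 2.19 (ii)) —
  **⟸ {hextPar, (H-b)}, EVERY `p`** (one term over p491715 with `h219iii` supplied by the first theorem; hextPar ⇒ hextΔ by
  dropping its parity conjunct).
RESIDUAL OF RECORD after this file (K4 rows 21 / Cor2.19(iii) cells): {hextΔ resp. hextPar = the [EtTh] Prop. 2.4 (i)-shape binder
of rows 19/22 (abc-iut-L6-d6 gen 5/6 verdict: undecided at the semi-synthetic model), (H-b) = the (β1)/M2 value clause (no producer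
in tree)} — and NOTHING else beyond data.

HONEST FRAMING: `modelχq` is a SEMI-SYNTHETIC model of the typed §1 interface (not the tempered `π₁` of a curve) — binder-discharge
evidence for OUR typed rows only; F-0650 / F-0625 / F-0639 / F-0647 stay FACT-policy rows (assumption labels by ID); hextΔ / hextPar /
(H-b) are DISPLAYED binders, not asserted; nothing of [EtTh] (refereed) is asserted beyond the displayed statements; no side is
taken on [IUTchIII] Cor. 3.12; typed ≠ proved; re-closed ≠ endorsed; nothing here says abc is proved or refuted.
-/

noncomputable section

namespace Literature.AnabelianGeometry.EtaleTheta.SettingModel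

open Literature.AnabelianGeometry.SemiGraphs _root_.Function _root_.Topology

variable (p : ℕ) [Fact p.Prime] {l : ℕ+} (hl : Odd (l : ℕ))
  (C : (etaleThetaDataχqInr p).DoubleUnderline l) (hHuu : C.Huu = Huuχq p 1 2 l hl) {Es : Set ℕ+}
  (τ : (ThetaSetting.modelχq p 1 2 even_two).CyclotomeTower l Es)

/- The displayed residual clause (H-b) of the row — abc-iut-L1-t6's (H) WITHOUT its Cor. 2.18 (i)-type conjuncts — as a section
variable (a binder, NOT a definition): for every admissible `(γ, hγ, γμ, hcompat)` and every induced `γΛ`, SOME root cocycle `f₀` and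
SOME `w ∈ Π^tp_X̲̲` give the value identity at `b₀` at every level. -/
variable (Hb : ∀ (γ : (C.thetaEnvTower τ (compat_modelχq p 1 2 even_two) (ThetaSetting.modelχq_sec2Hyps p 1 2 even_two)).PiX ≃ₜ*
        (C.thetaEnvTower τ (compat_modelχq p 1 2 even_two) (ThetaSetting.modelχq_sec2Hyps p 1 2 even_two)).PiX)
      (hγ : (C.thetaEnvTower τ (compat_modelχq p 1 2 even_two) (ThetaSetting.modelχq_sec2Hyps p 1 2 even_two)).PiYdd.map
          γ.toMulEquiv.toMonoidHom =
        (C.thetaEnvTower τ (compat_modelχq p 1 2 even_two) (ThetaSetting.modelχq_sec2Hyps p 1 2 even_two)).PiYdd)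
      (γμ : ∀ M : Es, (C.thetaEnvTower τ (compat_modelχq p 1 2 even_two) (ThetaSetting.modelχq_sec2Hyps p 1 2 even_two)).mu M ≃*
        (C.thetaEnvTower τ (compat_modelχq p 1 2 even_two) (ThetaSetting.modelχq_sec2Hyps p 1 2 even_two)).mu M)
      (_ : ∀ (M : Es) (g : (C.thetaEnvTower τ (compat_modelχq p 1 2 even_two) (ThetaSetting.modelχq_sec2Hyps p 1 2 even_two)).lDeltaTheta)
        (hg : γ g ∈ (C.thetaEnvTower τ (compat_modelχq p 1 2 even_two) (ThetaSetting.modelχq_sec2Hyps p 1 2 even_two)).lDeltaTheta),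
        (C.thetaEnvTower τ (compat_modelχq p 1 2 even_two) (ThetaSetting.modelχq_sec2Hyps p 1 2 even_two)).thetaMod M ⟨γ g, hg⟩ =
          γμ M ((C.thetaEnvTower τ (compat_modelχq p 1 2 even_two) (ThetaSetting.modelχq_sec2Hyps p 1 2 even_two)).thetaMod M g))
      (γΛ : (ThetaSetting.modelχq p 1 2 even_two).lDeltaTheta l ≃* (ThetaSetting.modelχq p 1 2 even_two).lDeltaTheta l)
      (_ : ∀ (g : (C.thetaEnvTower τ (compat_modelχq p 1 2 even_two) (ThetaSetting.modelχq_sec2Hyps p 1 2 even_two)).lDeltaTheta)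
          (hg : γ g ∈ (C.thetaEnvTower τ (compat_modelχq p 1 2 even_two) (ThetaSetting.modelχq_sec2Hyps p 1 2 even_two)).lDeltaTheta),
          C.toLDelta ⟨γ g, hg⟩ = γΛ (C.toLDelta g)),
        ∃ (f₀ : contCocycles (ThetaSetting.modelχq p 1 2 even_two).toTheta (ThetaSetting.modelχq p 1 2 even_two).DeltaTheta
            C.GtpYdduu)
          (hf₀ : f₀ ∈ C.rootCocycles (compat_modelχq p 1 2 even_two)) (w : C.Huu),
          ∀ M : Es,
            (τ.mod M).red (γΛ.symm ⟨(f₀.1 (C.inclYdduu ⟨γ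
                (⟨⟨(SemidirectProduct.inl (bPowGfp ((iotaZ (Multiplicative.ofAdd 1)) ^ 2)) : PiTpχq p 1 2),
                    hHuu.ge (inl_bPowGfp_mem_Huuχq p 1 2 l hl _)⟩,
                  inl_bPowGfp_sq_mem_GtpYdd_modelχq p 1 2 even_two _⟩ :
                  (C.thetaEnvTower τ (compat_modelχq p 1 2 even_two) (ThetaSetting.modelχq_sec2Hyps p 1 2 even_two)).PiYdd),
                C.apply_mem_PiYdd τ _ _ γ hγ _⟩) : (ThetaSetting.modelχq p 1 2 even_two).GtpTheta), hf₀.1 _⟩) =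
              (τ.mod M).red ⟨(C.conjRoot (compat_modelχq p 1 2 even_two) w f₀.1 (C.inclYdduu
                ⟨⟨(SemidirectProduct.inl (bPowGfp ((iotaZ (Multiplicative.ofAdd 1)) ^ 2)) : PiTpχq p 1 2),
                    hHuu.ge (inl_bPowGfp_mem_Huuχq p 1 2 l hl _)⟩,
                  inl_bPowGfp_sq_mem_GtpYdd_modelχq p 1 2 even_two _⟩) : (ThetaSetting.modelχq p 1 2 even_two).GtpTheta),
                ((ThetaSetting.modelχq p 1 2 even_two).lDeltaTheta_normal l).conj_mem _ (hf₀.1 _) _⟩)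

set_option synthInstance.maxHeartbeats 200000 in
set_option maxHeartbeats 1000000 in
include Hb in
/-- **F-0650 `ThetaEnvTower.Cor219_iii` at the datum of record FROM {hextΔ, (H-b)}**: abc-iut-L1-t6's
`cor219_iii_modelTate_inr_of_const_conjugator` (p490953) with the (H-a) half of its clause (H) — stability of `Ker(θ|_{Π^tp_X̲̲})`
and of the tower's `θ⁻¹(l·Δ_Θ)` under every admissible `γ` — DISCHARGED from hextΔ by this seat's base's backbone
(`map_subgroupOf_Huu_eq_of_extends` with `map_ker_toTheta_eq` / `map_comap_lDeltaTheta_eq`; the tower's subgroups ARE the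
setting's `Ker θ` / `θ⁻¹(l·Δ_Θ)` on `C.Huu`, rewritten by `MonoidHom.comap_ker` / `Subgroup.comap_comap`). The two `set_option`s
only raise elaboration limits for the nested carriers (as in p490953). [cite: MochizukiEtTh2009, Cor 2.19 (iii) p.64] -/
theorem cor219_iii_modelTate_inr_of_extends_of_value
    (hext : ∀ γ : ↥C.Huu ≃ₜ* ↥C.Huu, ∃ Γ : PiTpχq p 1 2 ≃ₜ* PiTpχq p 1 2,
      (∀ h : C.Huu, Γ (h : PiTpχq p 1 2) = ((γ h : C.Huu) : PiTpχq p 1 2)) ∧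
        (curveχq p 1 2).DeltaTemp.map Γ.toMulEquiv.toMonoidHom = (curveχq p 1 2).DeltaTemp) :
    (C.thetaEnvTower τ (compat_modelχq p 1 2 even_two) (ThetaSetting.modelχq_sec2Hyps p 1 2 even_two)).Cor219_iii := by
  refine cor219_iii_modelTate_inr_of_const_conjugator p hl C hHuu τ (fun γ hγ γμ hμ => ?_)
  obtain ⟨Γ, hΓ, hΔ⟩ := hext γ
  refine ⟨?_, ?_, fun γΛ hγΛ => Hb γ hγ γμ hμ γΛ hγΛ⟩
  · have h1 := C.map_subgroupOf_Huu_eq_of_extends γ Γ hΓ _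
      ((ThetaSetting.modelχq p 1 2 even_two).map_ker_toTheta_eq Γ hΔ)
    rw [← MonoidHom.comap_ker, Subgroup.comap_subtype]
    exact h1
  · have h2 := C.map_subgroupOf_Huu_eq_of_extends γ Γ hΓ _
      ((ThetaSetting.modelχq p 1 2 even_two).map_comap_lDeltaTheta_eq l Γ hΔ)
    change (((ThetaSetting.modelχq p 1 2 even_two).lDeltaTheta l).comap
        ((ThetaSetting.modelχq p 1 2 even_two).toTheta.comp C.Huu.subtype)).map γ.toMulEquiv.toMonoidHom =
      ((ThetaSetting.modelχq p 1 2 even_two).lDeltaTheta l).comap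
        ((ThetaSetting.modelχq p 1 2 even_two).toTheta.comp C.Huu.subtype)
    rw [← Subgroup.comap_comap, Subgroup.comap_subtype]
    exact h2

include Hb in
/-- hextPar ⇒ hextΔ (drop the parity conjunct): **F-0650 at the datum ⟸ {hextPar, (H-b)}**, every `p`.
[cite: MochizukiEtTh2009, Cor 2.19 (iii) p.64] -/
theorem cor219_iii_modelTate_inr_of_extends_of_parity_of_value
    (hextPar : ∀ γ : ↥C.Huu ≃ₜ* ↥C.Huu, ∃ Γ : PiTpχq p 1 2 ≃ₜ* PiTpχq p 1 2,
      (∀ h : C.Huu, Γ (h : PiTpχq p 1 2) = ((γ h : C.Huu) : PiTpχq p 1 2)) ∧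
        (curveχq p 1 2).DeltaTemp.map Γ.toMulEquiv.toMonoidHom = (curveχq p 1 2).DeltaTemp ∧
        (levelHom 2 (Γ (SemidirectProduct.inl (gfpOf (FreeGroup.of 0)))).left).y = 0) :
    (C.thetaEnvTower τ (compat_modelχq p 1 2 even_two) (ThetaSetting.modelχq_sec2Hyps p 1 2 even_two)).Cor219_iii :=
  cor219_iii_modelTate_inr_of_extends_of_value p hl C hHuu τ Hb fun γ =>
    let ⟨Γ, hΓ, hΔ, _⟩ := hextPar γ
    ⟨Γ, hΓ, hΔ⟩

include Hb in
/-- **F-0625 `RigidData.Cor218_iv_surjective` at every `modAll` level of the datum of record ⟸ {hextPar, (H-b)}, EVERY `p`**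
(abc-iut-f-148's `…_of_extends_of_parity`, p491715, with `h219iii` SUPPLIED by the first theorem).
[cite: MochizukiEtTh2009, Cor 2.18 (iv) p.61] -/
theorem rigidData_cor218_iv_surjective_modAll_modelTate_inr_of_extends_of_value (M : ℕ+)
    (hextPar : ∀ γ : ↥C.Huu ≃ₜ* ↥C.Huu, ∃ Γ : PiTpχq p 1 2 ≃ₜ* PiTpχq p 1 2,
      (∀ h : C.Huu, Γ (h : PiTpχq p 1 2) = ((γ h : C.Huu) : PiTpχq p 1 2)) ∧
        (curveχq p 1 2).DeltaTemp.map Γ.toMulEquiv.toMonoidHom = (curveχq p 1 2).DeltaTemp ∧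
        (levelHom 2 (Γ (SemidirectProduct.inl (gfpOf (FreeGroup.of 0)))).left).y = 0) :
    (C.rigidData (τ.modAll M) (compat_modelχq p 1 2 even_two) (ThetaSetting.modelχq_sec2Hyps p 1 2 even_two)
      (prop15iii_etaleThetaDataχqInr p _) ⟨fun _ => ∅, fun _ => ∅, fun _ => rfl⟩).Cor218_iv_surjective :=
  rigidData_cor218_iv_surjective_modAll_modelTate_inr_of_extends_of_parity p C τ M hextPar
    (cor219_iii_modelTate_inr_of_extends_of_parity_of_value p hl C hHuu τ Hb hextPar)

include Hb in
/-- **F-0639 the same in `ThetaEnvData` currency** (layer L6's [IUTchII] Prop. 1.5 bridge input `hsurj`) ⟸ {hextPar, (H-b)},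
EVERY `p`. [cite: MochizukiEtTh2009, Cor 2.18 (iv) p.61] -/
theorem thetaEnvData_cor218_iv_surjective_modAll_modelTate_inr_of_extends_of_value (M : ℕ+)
    (hextPar : ∀ γ : ↥C.Huu ≃ₜ* ↥C.Huu, ∃ Γ : PiTpχq p 1 2 ≃ₜ* PiTpχq p 1 2,
      (∀ h : C.Huu, Γ (h : PiTpχq p 1 2) = ((γ h : C.Huu) : PiTpχq p 1 2)) ∧
        (curveχq p 1 2).DeltaTemp.map Γ.toMulEquiv.toMonoidHom = (curveχq p 1 2).DeltaTemp ∧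
        (levelHom 2 (Γ (SemidirectProduct.inl (gfpOf (FreeGroup.of 0)))).left).y = 0) :
    (C.thetaEnvData (τ.modAll M) (compat_modelχq p 1 2 even_two)
      (ThetaSetting.modelχq_sec2Hyps p 1 2 even_two)).Cor218_iv_surjective :=
  thetaEnvData_cor218_iv_surjective_modAll_modelTate_inr_of_extends_of_parity p C τ M hextPar
    (cor219_iii_modelTate_inr_of_extends_of_parity_of_value p hl C hHuu τ Hb hextPar)

include Hb in
/-- **F-0647 odd bijectivity of Cor. 2.18 (iv) for the tower of the datum of record ⟸ {hextPar, (H-b)}, EVERY `p`**.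
[cite: MochizukiEtTh2009, Cor 2.18 (iv) p.61] -/
theorem cor218_iv_bijective_of_odd_modelTate_inr_of_extends_of_value
    (hextPar : ∀ γ : ↥C.Huu ≃ₜ* ↥C.Huu, ∃ Γ : PiTpχq p 1 2 ≃ₜ* PiTpχq p 1 2,
      (∀ h : C.Huu, Γ (h : PiTpχq p 1 2) = ((γ h : C.Huu) : PiTpχq p 1 2)) ∧
        (curveχq p 1 2).DeltaTemp.map Γ.toMulEquiv.toMonoidHom = (curveχq p 1 2).DeltaTemp ∧
        (levelHom 2 (Γ (SemidirectProduct.inl (gfpOf (FreeGroup.of 0)))).left).y = 0) :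
    (C.thetaEnvTower τ (compat_modelχq p 1 2 even_two) (ThetaSetting.modelχq_sec2Hyps p 1 2 even_two)).Cor218_iv_bijective_of_odd :=
  cor218_iv_bijective_of_odd_modelTate_inr_of_extends_of_parity p C τ hextPar
    (cor219_iii_modelTate_inr_of_extends_of_parity_of_value p hl C hHuu τ Hb hextPar)

include Hb in
/-- **The §2 tower-row census conjunction at the datum of record** (Cor. 2.16 ∧ Cor. 2.18 (iv) reduction ∧ odd bijectivity ∧
Cor. 2.19 (ii), abc-iut-f-148's `sec2_tower_rows_modelTate_inr_of_extends_of_parity`) **⟸ {hextPar, (H-b)}, EVERY `p`**.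
[cite: MochizukiEtTh2009, Cor 2.19 (ii) p.64] -/
theorem sec2_tower_rows_modelTate_inr_of_extends_of_value
    (hextPar : ∀ γ : ↥C.Huu ≃ₜ* ↥C.Huu, ∃ Γ : PiTpχq p 1 2 ≃ₜ* PiTpχq p 1 2,
      (∀ h : C.Huu, Γ (h : PiTpχq p 1 2) = ((γ h : C.Huu) : PiTpχq p 1 2)) ∧
        (curveχq p 1 2).DeltaTemp.map Γ.toMulEquiv.toMonoidHom = (curveχq p 1 2).DeltaTemp ∧
        (levelHom 2 (Γ (SemidirectProduct.inl (gfpOf (FreeGroup.of 0)))).left).y = 0) :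
    (C.thetaEnvTower τ (compat_modelχq p 1 2 even_two) (ThetaSetting.modelχq_sec2Hyps p 1 2 even_two)).Cor216 ∧ (C.thetaEnvTower τ (compat_modelχq p 1 2 even_two) (ThetaSetting.modelχq_sec2Hyps p 1 2 even_two)).Cor218_iv_reduction ∧ (C.thetaEnvTower τ (compat_modelχq p 1 2 even_two) (ThetaSetting.modelχq_sec2Hyps p 1 2 even_two)).Cor218_iv_bijective_of_odd ∧ (C.thetaEnvTower τ (compat_modelχq p 1 2 even_two) (ThetaSetting.modelχq_sec2Hyps p 1 2 even_two)).Cor219_ii :=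
  sec2_tower_rows_modelTate_inr_of_extends_of_parity p C τ hextPar
    (cor219_iii_modelTate_inr_of_extends_of_parity_of_value p hl C hHuu τ Hb hextPar)

end Literature.AnabelianGeometry.EtaleTheta.SettingModel

end
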